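import Mathlib
import Literature.MathematicalPhysics.QuantumLattice.HubbardBandSectorCountingToolbox
import HarnessLib

/-!
# Four-sector counting, fold ranges: level counts of the diagonal function on its TRANSVERSAL rows (no `√η` term)

Topic `Literature/MathematicalPhysics/QuantumLattice`; sub-namespace `BandSectorCounting` (continues `HubbardBandSectorCountingToolbox`).
Part (F3c, class (T)) of the log-free ANISOTROPIC anchored four-sector counting lemma («E1-P2-THIN-COUNT», cell gate-hubbard-kl, plan g17 (R41); seat p4; plan
HOME/prover-p4/E1-P2-THIN-COUNT-PLAN.md §Refinement 4 / «(F3c) intended statement»).  The isotropic fold sum feeds the per-anti-diagonal count `≍ δ/(w√|D(σ)|)`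
through the level counts `#{σ : |D(σ)| ≤ η} ≤ Xη/w + Y√η/w + Z` of the diagonal function `D(σ) = h(θ₁; σ, σ)` (`count_levels_diag`), whose `√η` term (rows near a
critical point of `D`) is the source of the dyadic `(J+1)`.  The two-regime sum separates the rows: near-critical rows go to the sharp count
(`level_count_near_min_sharp`) or are killed (`row_kill_*`), and the TRANSVERSAL rows `|D′(σ)| ≥ 2λ` are counted here WITHOUT a `√η` term — lemma L2 of the
Toolbox applied to `D` on the `σ` half-grid (`D′` is `(16 s_max² + 8A₂)`-Lipschitz):

* **`abs_diag_deriv_sub_le`** — `|D′(σ) − D′(σ′)| ≤ (16s_max² + 8A₂)·|σ − σ′|`;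
* **`count_levels_diag_transversal`** — `#{s < K : |D(x₀ + s·h)| ≤ η ∧ 2λ ≤ |D′(x₀ + s·h)|} ≤ (K·h/(2λ/(2A_D)) + 1)·2(4η/(2λ)/h + 1)`, `A_D = 16s_max² + 8A₂`
  (on the fold grid `x₀ = w/2`, `h = w/2`, `K = 4N`: `O(η/w + 1)` rows at level `η`, so `Σ_levels (η/w)·(δ/(w√η)) = O(δ√η₀/w²)` — no logarithm).

Everything is PROVED; no definitions, no named facts.

## Sources

* G. Benfatto, A. Giuliani, V. Mastropietro, Ann. Henri Poincaré 7 (2006) 809–898, Lemma 3.1 / App. A2. [BenfattoGiulianiMastropietro2006]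
* V. Mastropietro, *Non-Perturbative Renormalization* (World Scientific, 2008), ch. 14, (14.67) p. 223; p. 229. [Mastropietro2008]
-/

noncomputable section

open Real Set
open Literature.MathematicalPhysics.QuantumLattice

namespace Literature.MathematicalPhysics.QuantumLattice.BandSectorCounting

section Transversal

variable {a b : ℝ} (B : BandBounds a b) {μ : ℝ} (hμ : μ ∈ Icc a b)
include B hμ

/-- **The diagonal slope is Lipschitz**: `|D′(σ) − D′(σ′)| ≤ (16 s_max² + 8A₂)·|σ − σ′|` for `D′(σ) = 4(sin S_x·x′(σ) + sin S_y·y′(σ))`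
(mean value theorem with `|D″| ≤ 16 s_max² + 8A₂`, `abs_diag_deriv2_le`). [cite: BenfattoGiulianiMastropietro2006, Lemma 3.1 / App. A2] -/
theorem abs_diag_deriv_sub_le (θ₁ σ σ' : ℝ) :
    |4 * (Real.sin (SX μ θ₁ σ σ) * bandVX μ σ + Real.sin (SY μ θ₁ σ σ) * bandVY μ σ) -
        4 * (Real.sin (SX μ θ₁ σ' σ') * bandVX μ σ' + Real.sin (SY μ θ₁ σ' σ') * bandVY μ σ')| ≤
      (16 * B.smax ^ 2 + 8 * B.A2) * |σ - σ'| := by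
  obtain ⟨h1, h2⟩ := B.level hμ
  have hd := hasDerivAt_hfun_diag_zero_deriv h1 h2 θ₁
  have h := Convex.norm_image_sub_le_of_norm_hasDerivWithin_le (fun t _ => (hd t).hasDerivWithinAt)
    (fun t _ => by rw [Real.norm_eq_abs]; exact abs_diag_deriv2_le B hμ θ₁ t) (convex_uIcc σ' σ) left_mem_uIcc right_mem_uIcc
  rw [Real.norm_eq_abs, Real.norm_eq_abs] at h
  exact h

/-- **Level count of the diagonal function on its transversal rows** (lemma L2 for `D`): on a grid `x₀ + s·h`, `s < K`,
`#{s : |D(x₀ + s h)| ≤ η ∧ 2λ ≤ |D′(x₀ + s h)|} ≤ (K h/(2λ/(2A_D)) + 1)·2(4η/(2λ)/h + 1)`, `A_D = 16 s_max² + 8A₂` — linear in `η`, NO `√η`.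
[cite: BenfattoGiulianiMastropietro2006, Lemma 3.1 / App. A2] -/
theorem count_levels_diag_transversal {θ₁ x₀ h η lam : ℝ} (hh : 0 < h) (hη : 0 ≤ η) (hlam : 0 < lam) (K : ℕ) :
    ((((Finset.range K).filter fun s : ℕ =>
        |hfun μ θ₁ (x₀ + s * h) (x₀ + s * h)| ≤ η ∧
          2 * lam ≤ |4 * (Real.sin (SX μ θ₁ (x₀ + s * h) (x₀ + s * h)) * bandVX μ (x₀ + s * h) +
            Real.sin (SY μ θ₁ (x₀ + s * h) (x₀ + s * h)) * bandVY μ (x₀ + s * h))|).card : ℝ)) ≤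
      (K * h / (2 * lam / (2 * (16 * B.smax ^ 2 + 8 * B.A2))) + 1) * (2 * ((4 * η / (2 * lam)) / h + 1)) := by
  obtain ⟨h1, h2⟩ := B.level hμ
  have hs := B.smax_pos; have hA := B.A2_pos
  exact gridCount_L2 (g := fun x => hfun μ θ₁ x x)
    (g' := fun x => 4 * (Real.sin (SX μ θ₁ x x) * bandVX μ x + Real.sin (SY μ θ₁ x x) * bandVY μ x))
    (hasDerivAt_hfun_diag_zero h1 h2 θ₁) (A := 16 * B.smax ^ 2 + 8 * B.A2) (lam := 2 * lam) (δ := η)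
    (by positivity) (by positivity) hη (abs_diag_deriv_sub_le B hμ θ₁) hh K

end Transversal

end Literature.MathematicalPhysics.QuantumLattice.BandSectorCounting

end
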